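import Summits.AtomisticToContinuum.Crystallization.Theorems.ChartedZeroExcessLayeredLatticeLiouvilleZZZYRCM
import Summits.AtomisticToContinuum.Crystallization.Theorems.ChartedZeroExcessLayeredLatticeLiouvilleZZZYRCHA

/-!
# Charted zero-excess layered-lattice Liouville — ZZZYRCU: the PER-BOND SECOND-DERIVATIVE LEMMA `∂ₜ²⟪d, K(x + t u) d⟫ ≤ |u|²·Φ(q)·|d|²`

Cell `decomp-a2c`, lens 2, generation 99.  CELLBOX-K's between-grid closure (ZZZYRCM `vertex_interp_box`) needs, per box axis, a bound on the
PURE second derivative of the certified quadratic form; the form is a finite sum over bonds `b` of `⟪Δ_b v, K(e_b(ξ)) Δ_b v⟫` with the tree's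
Lennard-Jones force-constant operator `K = forceConst` (B) and bond vectors AFFINE in the gauge-fixed box coordinates, `e_b(ξ + t·axis) = x_b + t·u_b`.
This file is the analytic `L_aa` recipe of record (critic r1826, memo NODE-g99 §8.4) as a tree lemma:

* §1 `ljRadH0 … ljRadH3` — the radial coefficient `h(q) = −q⁻⁷ + q⁻⁴` of `K(w) = h(q)·1 + 2h′(q)·w⊗w` (`q = |w|²`) and its three derivatives,
  written as polynomials in `S = q⁻¹`; `inner_forceConst_eq_rad` (`⟪d, K(w) d⟫ = h‖d‖² + 2h′⟪w,d⟫²`);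
* §2 the affine bond path: `bondPathQ` (`= ‖x + t u‖²`, a quadratic polynomial), `bondPathQ1` (its derivative `2⟪x + t u, u⟫`), `bondPathP`
  (`⟪x + t u, d⟫`), `bondS = bondPathQ⁻¹`, with their `HasDerivAt`s;
* §3 `bondQF x u d t := ⟪d, forceConst (x + t • u) d⟫`, its first and second derivatives `bondQF1`, `bondQF2` (closed forms, `HasDerivAt` proved
  wherever the bond is non-zero);
* §4 ★ `bondQF2_le`: `bondQF2 ≤ ‖u‖²·Φ(S)·‖d‖²`, `Φ(S) = ljPhiS S = 5418 S⁸ + 1464 S⁵` (= `5418 q⁻⁸ + 1464 q⁻⁵`; 6882 at `|w| = 1`, 1.5e4 at 0.95,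
  16 at the second shell) — triangle inequality + Cauchy–Schwarz term by term; `ljPhiS_mono`;
* §5 ★★ `bondQF_concaveOn` — the RCM entry point discharged: on a parameter interval where `‖x + t u‖² ≥ q₀ > 0`,
  `t ↦ bondQF x u d t − (‖u‖² Φ(q₀⁻¹) ‖d‖²)/2 · t²` is concave; `concaveOn_sum_sub_sq` (finite sums of bonds: the constants add),
  `concaveOn_sub_sq_mono` (a larger constant is still fine) — so the K-file's per-axis `L a` is `Σ_b ‖u_b‖² Φ(q₀,b⁻¹) ‖Δ_b v‖²` or any upper bound
  of it, and census's halving-depth tags become certified, not trusted.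

Theorem file (12 defs: explicit closed-form real functions, no predicates; 21 theorems); imports tree ZZZYRCM + ZZZYRCHA; no instance / notation /
option; 0 sorry. [g99]
-/

open scoped BigOperators InnerProductSpace RealInnerProductSpace

namespace Summit.AtomisticToContinuum.Crystallization.Theorems.ChartedZeroExcessLayeredLatticeLiouville

open Summit.AtomisticToContinuum.Crystallization.Theorems.ChartedPlanarOrderRigidityDoor (E3)

/-! ### §1 The radial coefficients of the Lennard-Jones force constant, as polynomials in `S = |w|⁻²` -/

/-- `h(q) = −q⁻⁷ + q⁻⁴` in the variable `S = q⁻¹`. [g99] -/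
noncomputable def ljRadH0 (S : ℝ) : ℝ := -S ^ 7 + S ^ 4

/-- `h′(q) = 7q⁻⁸ − 4q⁻⁵` in `S = q⁻¹`. [g99] -/
noncomputable def ljRadH1 (S : ℝ) : ℝ := 7 * S ^ 8 - 4 * S ^ 5

/-- `h″(q) = −56q⁻⁹ + 20q⁻⁶` in `S = q⁻¹`. [g99] -/
noncomputable def ljRadH2 (S : ℝ) : ℝ := -56 * S ^ 9 + 20 * S ^ 6

/-- `h‴(q) = 504q⁻¹⁰ − 120q⁻⁷` in `S = q⁻¹`. [g99] -/
noncomputable def ljRadH3 (S : ℝ) : ℝ := 504 * S ^ 10 - 120 * S ^ 7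

/-- the crude second-derivative profile `Φ = 5418 S⁸ + 1464 S⁵` (`= 5418 q⁻⁸ + 1464 q⁻⁵`). [g99] -/
noncomputable def ljPhiS (S : ℝ) : ℝ := 5418 * S ^ 8 + 1464 * S ^ 5

/-- the quadratic form of the tree's `forceConst` in radial coefficients: `⟪d, K(w) d⟫ = h(q)‖d‖² + 2h′(q)⟪w, d⟫²`, `q = ‖w‖²`. [g99] -/
theorem inner_forceConst_eq_rad (w d : E3) :
    ⟪d, forceConst w d⟫ = ljRadH0 (‖w‖ ^ 2)⁻¹ * ‖d‖ ^ 2 + 2 * ljRadH1 (‖w‖ ^ 2)⁻¹ * ⟪w, d⟫ ^ 2 := by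
  rw [forceConst_apply, inner_add_right, real_inner_smul_right, real_inner_smul_right, real_inner_self_eq_norm_sq, real_inner_comm w d]
  unfold ljRadH0 ljRadH1
  ring

/-- `Φ` is monotone in `S ≥ 0` (i.e. antitone in the bond length). [g99] -/
theorem ljPhiS_mono {S S₀ : ℝ} (hS : 0 ≤ S) (h : S ≤ S₀) : ljPhiS S ≤ ljPhiS S₀ := by
  unfold ljPhiS
  have h8 := pow_le_pow_left₀ hS h 8
  have h5 := pow_le_pow_left₀ hS h 5
  linarith

/-! ### §2 The affine bond path `t ↦ x + t • u` -/

/-- `‖x + t u‖²` as the quadratic polynomial `‖x‖² + 2⟪x,u⟫ t + ‖u‖² t²`. [g99] -/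
noncomputable def bondPathQ (x u : E3) (t : ℝ) : ℝ := ‖x‖ ^ 2 + 2 * ⟪x, u⟫ * t + ‖u‖ ^ 2 * t ^ 2

/-- its derivative `2⟪x,u⟫ + 2‖u‖² t = 2⟪x + t u, u⟫`. [g99] -/
noncomputable def bondPathQ1 (x u : E3) (t : ℝ) : ℝ := 2 * ⟪x, u⟫ + 2 * ‖u‖ ^ 2 * t

/-- `⟪x + t u, d⟫` as the affine function `⟪x,d⟫ + ⟪u,d⟫ t`. [g99] -/
noncomputable def bondPathP (x u d : E3) (t : ℝ) : ℝ := ⟪x, d⟫ + ⟪u, d⟫ * t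

/-- `S(t) = ‖x + t u‖⁻²`. [g99] -/
noncomputable def bondS (x u : E3) (t : ℝ) : ℝ := (bondPathQ x u t)⁻¹

/-- the polynomial is the squared bond length. [g99] -/
theorem bondPathQ_eq_norm_sq (x u : E3) (t : ℝ) : bondPathQ x u t = ‖x + t • u‖ ^ 2 := by
  rw [norm_add_sq_real, real_inner_smul_right, norm_smul, mul_pow, Real.norm_eq_abs, sq_abs]
  unfold bondPathQ
  ring

/-- the derivative polynomial is `2⟪x + t u, u⟫`. [g99] -/
theorem bondPathQ1_eq_inner (x u : E3) (t : ℝ) : bondPathQ1 x u t = 2 * ⟪x + t • u, u⟫ := by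
  rw [inner_add_left, real_inner_smul_left, real_inner_self_eq_norm_sq]
  unfold bondPathQ1
  ring

/-- the affine function is `⟪x + t u, d⟫`. [g99] -/
theorem bondPathP_eq_inner (x u d : E3) (t : ℝ) : bondPathP x u d t = ⟪x + t • u, d⟫ := by
  rw [inner_add_left, real_inner_smul_left]
  unfold bondPathP
  ring

/-- `HasDerivAt` of the squared length. [g99] -/
theorem hasDerivAt_bondPathQ (x u : E3) (t : ℝ) : HasDerivAt (bondPathQ x u) (bondPathQ1 x u t) t := by
  have h : HasDerivAt (fun y => ‖x‖ ^ 2 + 2 * ⟪x, u⟫ * y + ‖u‖ ^ 2 * (y * y))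
      (0 + 2 * ⟪x, u⟫ * 1 + ‖u‖ ^ 2 * (1 * t + t * 1)) t :=
    ((hasDerivAt_const t _).add ((hasDerivAt_id t).const_mul _)).add (((hasDerivAt_id t).mul (hasDerivAt_id t)).const_mul _)
  have e : bondPathQ x u = fun y => ‖x‖ ^ 2 + 2 * ⟪x, u⟫ * y + ‖u‖ ^ 2 * (y * y) := by
    funext y; unfold bondPathQ; ring
  rw [e]
  exact h.congr_deriv (by unfold bondPathQ1; ring)

/-- `HasDerivAt` of the derivative polynomial (second derivative `2‖u‖²`). [g99] -/
theorem hasDerivAt_bondPathQ1 (x u : E3) (t : ℝ) : HasDerivAt (bondPathQ1 x u) (2 * ‖u‖ ^ 2) t := by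
  have h : HasDerivAt (fun y => 2 * ⟪x, u⟫ + 2 * ‖u‖ ^ 2 * y) (0 + 2 * ‖u‖ ^ 2 * 1) t :=
    (hasDerivAt_const t _).add ((hasDerivAt_id t).const_mul _)
  have e : bondPathQ1 x u = fun y => 2 * ⟪x, u⟫ + 2 * ‖u‖ ^ 2 * y := by funext y; rfl
  rw [e]
  exact h.congr_deriv (by ring)

/-- `HasDerivAt` of the affine function. [g99] -/
theorem hasDerivAt_bondPathP (x u d : E3) (t : ℝ) : HasDerivAt (bondPathP x u d) ⟪u, d⟫ t := by
  have h : HasDerivAt (fun y => ⟪x, d⟫ + ⟪u, d⟫ * y) (0 + ⟪u, d⟫ * 1) t :=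
    (hasDerivAt_const t _).add ((hasDerivAt_id t).const_mul _)
  have e : bondPathP x u d = fun y => ⟪x, d⟫ + ⟪u, d⟫ * y := by funext y; rfl
  rw [e]
  exact h.congr_deriv (by ring)

/-- `HasDerivAt` of `S = Q⁻¹` away from the zero bond: `S′ = −Q′·S²`. [g99] -/
theorem hasDerivAt_bondS (x u : E3) {t : ℝ} (hq : bondPathQ x u t ≠ 0) :
    HasDerivAt (bondS x u) (-(bondPathQ1 x u t) * bondS x u t ^ 2) t := by
  have h := (hasDerivAt_bondPathQ x u t).fun_inv hq
  have e : bondS x u = fun y => (bondPathQ x u y)⁻¹ := by funext y; rfl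
  rw [e]
  refine h.congr_deriv ?_
  simp only [div_eq_mul_inv, inv_pow, neg_mul]

/-- powers of a differentiable function (the form used below: exponent `n + 1`, no truncated subtraction). [g99] -/
theorem hasDerivAt_Spow {S : ℝ → ℝ} {S' t : ℝ} (hS : HasDerivAt S S' t) (n : ℕ) :
    HasDerivAt (fun y => S y ^ (n + 1)) ((n + 1 : ℝ) * S t ^ n * S') t := by
  have h := hS.fun_pow (n + 1)
  simpa using h

/-- chain rule for `h(S(t))`: derivative `Q′·h′`. [g99] -/
theorem hasDerivAt_ljRadH0_bondS (x u : E3) {t : ℝ} (hq : bondPathQ x u t ≠ 0) :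
    HasDerivAt (fun y => ljRadH0 (bondS x u y)) (bondPathQ1 x u t * ljRadH1 (bondS x u t)) t := by
  have hS := hasDerivAt_bondS x u hq
  have h := (hasDerivAt_Spow hS 6).neg.add (hasDerivAt_Spow hS 3)
  have e : (fun y => ljRadH0 (bondS x u y)) = fun y => -(bondS x u y ^ (6 + 1)) + bondS x u y ^ (3 + 1) := by
    funext y; unfold ljRadH0; norm_num
  rw [e]
  exact h.congr_deriv (by unfold ljRadH1; push_cast; ring)

/-- chain rule for `h′(S(t))`: derivative `Q′·h″`. [g99] -/
theorem hasDerivAt_ljRadH1_bondS (x u : E3) {t : ℝ} (hq : bondPathQ x u t ≠ 0) :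
    HasDerivAt (fun y => ljRadH1 (bondS x u y)) (bondPathQ1 x u t * ljRadH2 (bondS x u t)) t := by
  have hS := hasDerivAt_bondS x u hq
  have h := ((hasDerivAt_Spow hS 7).const_mul 7).sub ((hasDerivAt_Spow hS 4).const_mul 4)
  have e : (fun y => ljRadH1 (bondS x u y)) = fun y => 7 * bondS x u y ^ (7 + 1) - 4 * bondS x u y ^ (4 + 1) := by
    funext y; unfold ljRadH1; norm_num
  rw [e]
  exact h.congr_deriv (by unfold ljRadH2; push_cast; ring)

/-- chain rule for `h″(S(t))`: derivative `Q′·h‴`. [g99] -/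
theorem hasDerivAt_ljRadH2_bondS (x u : E3) {t : ℝ} (hq : bondPathQ x u t ≠ 0) :
    HasDerivAt (fun y => ljRadH2 (bondS x u y)) (bondPathQ1 x u t * ljRadH3 (bondS x u t)) t := by
  have hS := hasDerivAt_bondS x u hq
  have h := ((hasDerivAt_Spow hS 8).const_mul (-56)).add ((hasDerivAt_Spow hS 5).const_mul 20)
  have e : (fun y => ljRadH2 (bondS x u y)) = fun y => -56 * bondS x u y ^ (8 + 1) + 20 * bondS x u y ^ (5 + 1) := by
    funext y; unfold ljRadH2; norm_num
  rw [e]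
  exact h.congr_deriv (by unfold ljRadH3; push_cast; ring)

/-! ### §3 The bond quadratic form along the path and its two derivatives -/

/-- ★ the bond quadratic form along the affine bond path: `⟪d, K(x + t u) d⟫`. [g99] -/
noncomputable def bondQF (x u d : E3) (t : ℝ) : ℝ := ⟪d, forceConst (x + t • u) d⟫

/-- closed form of its first derivative (`Q′ = bondPathQ1`, `P = bondPathP`, `P′ = ⟪u,d⟫`). [g99] -/
noncomputable def bondQF1 (x u d : E3) (t : ℝ) : ℝ :=
  bondPathQ1 x u t * ljRadH1 (bondS x u t) * ‖d‖ ^ 2 +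
    2 * (bondPathQ1 x u t * ljRadH2 (bondS x u t) * bondPathP x u d t ^ 2 +
      ljRadH1 (bondS x u t) * (2 * bondPathP x u d t * ⟪u, d⟫))

/-- closed form of its second derivative:
`(2‖u‖² h′ + Q′² h″)‖d‖² + 2(2‖u‖² h″ + Q′² h‴)P² + 8 Q′ h″ P P′ + 4 h′ P′²`. [g99] -/
noncomputable def bondQF2 (x u d : E3) (t : ℝ) : ℝ :=
  (2 * ‖u‖ ^ 2 * ljRadH1 (bondS x u t) + bondPathQ1 x u t ^ 2 * ljRadH2 (bondS x u t)) * ‖d‖ ^ 2 +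
    2 * (2 * ‖u‖ ^ 2 * ljRadH2 (bondS x u t) + bondPathQ1 x u t ^ 2 * ljRadH3 (bondS x u t)) * bondPathP x u d t ^ 2 +
    8 * bondPathQ1 x u t * ljRadH2 (bondS x u t) * bondPathP x u d t * ⟪u, d⟫ +
    4 * ljRadH1 (bondS x u t) * ⟪u, d⟫ ^ 2

/-- the form in radial coefficients along the path. [g99] -/
theorem bondQF_eq (x u d : E3) (t : ℝ) :
    bondQF x u d t = ljRadH0 (bondS x u t) * ‖d‖ ^ 2 + 2 * ljRadH1 (bondS x u t) * bondPathP x u d t ^ 2 := by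
  unfold bondQF bondS
  rw [inner_forceConst_eq_rad, bondPathQ_eq_norm_sq, bondPathP_eq_inner]

/-- ★ first derivative of the bond form (bond non-zero at `t`). [g99] -/
theorem hasDerivAt_bondQF (x u d : E3) {t : ℝ} (hq : bondPathQ x u t ≠ 0) :
    HasDerivAt (bondQF x u d) (bondQF1 x u d t) t := by
  have hP := hasDerivAt_bondPathP x u d t
  have h := ((hasDerivAt_ljRadH0_bondS x u hq).mul_const (‖d‖ ^ 2)).add
    (((hasDerivAt_ljRadH1_bondS x u hq).mul (hP.mul hP)).const_mul 2)
  have e : bondQF x u d = fun y => ljRadH0 (bondS x u y) * ‖d‖ ^ 2 +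
      2 * (ljRadH1 (bondS x u y) * (bondPathP x u d y * bondPathP x u d y)) := by
    funext y; rw [bondQF_eq]; ring
  rw [e]
  exact h.congr_deriv (by simp only [Pi.mul_apply]; unfold bondQF1; ring)

/-- ★ second derivative of the bond form (bond non-zero at `t`). [g99] -/
theorem hasDerivAt_bondQF1 (x u d : E3) {t : ℝ} (hq : bondPathQ x u t ≠ 0) :
    HasDerivAt (bondQF1 x u d) (bondQF2 x u d t) t := by
  have hP := hasDerivAt_bondPathP x u d t
  have hQ1 := hasDerivAt_bondPathQ1 x u t
  have hH1 := hasDerivAt_ljRadH1_bondS x u hq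
  have hH2 := hasDerivAt_ljRadH2_bondS x u hq
  have hA := (hQ1.mul hH1).mul_const (‖d‖ ^ 2)
  have hB := (hQ1.mul hH2).mul (hP.mul hP)
  have hC := hH1.mul ((hP.const_mul 2).mul_const ⟪u, d⟫)
  have h := hA.add ((hB.add hC).const_mul 2)
  have e : bondQF1 x u d = fun y => bondPathQ1 x u y * ljRadH1 (bondS x u y) * ‖d‖ ^ 2 +
      2 * (bondPathQ1 x u y * ljRadH2 (bondS x u y) * (bondPathP x u d y * bondPathP x u d y) +
        ljRadH1 (bondS x u y) * (2 * bondPathP x u d y * ⟪u, d⟫)) := by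
    funext y; unfold bondQF1; ring
  rw [e]
  exact h.congr_deriv (by simp only [Pi.mul_apply]; unfold bondQF2; ring)

/-! ### §4 The crude bound `∂ₜ² ≤ ‖u‖² Φ ‖d‖²` -/

/-- a triple product is bounded by the product of absolute bounds. [g99] -/
theorem mul3_le_of_abs {a b c a' b' c' : ℝ} (ha : |a| ≤ a') (hb : |b| ≤ b') (hc : |c| ≤ c') :
    a * b * c ≤ a' * b' * c' := by
  have ha0 : 0 ≤ a' := (abs_nonneg a).trans ha
  have hb0 : 0 ≤ b' := (abs_nonneg b).trans hb
  have h1 : |a| * |b| ≤ a' * b' := mul_le_mul ha hb (abs_nonneg _) ha0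
  have h2 : |a| * |b| * |c| ≤ a' * b' * c' := mul_le_mul h1 hc (abs_nonneg _) (mul_nonneg ha0 hb0)
  calc a * b * c ≤ |a * b * c| := le_abs_self _
    _ = |a| * |b| * |c| := by rw [abs_mul, abs_mul]
    _ ≤ a' * b' * c' := h2

/-- ★ **THE PER-BOND BOUND**: at a non-zero bond, `bondQF2 ≤ ‖u‖²·Φ(‖x + t u‖⁻²)·‖d‖²`, `Φ = 5418 S⁸ + 1464 S⁵`. [g99] -/
theorem bondQF2_le (x u d : E3) {t : ℝ} (hq : 0 < bondPathQ x u t) :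
    bondQF2 x u d t ≤ ‖u‖ ^ 2 * ljPhiS (bondS x u t) * ‖d‖ ^ 2 := by
  set w : E3 := x + t • u with hw
  set Q := bondPathQ x u t with hQdef
  set S := bondS x u t with hSdef
  set Q1 := bondPathQ1 x u t with hQ1def
  set P := bondPathP x u d t with hPdef
  have hwQ : ‖w‖ ^ 2 = Q := (bondPathQ_eq_norm_sq x u t).symm
  have hQ1 : Q1 = 2 * ⟪w, u⟫ := bondPathQ1_eq_inner x u t
  have hP : P = ⟪w, d⟫ := bondPathP_eq_inner x u d t
  have hS0 : 0 < S := inv_pos.mpr hq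
  have hQS : Q * S = 1 := mul_inv_cancel₀ hq.ne'
  have h5 := pow_pos hS0 5; have h6 := pow_pos hS0 6; have h7 := pow_pos hS0 7; have h8 := pow_pos hS0 8
  have h9 := pow_pos hS0 9; have h10 := pow_pos hS0 10
  -- absolute bounds on the atoms
  have aQ1 : |Q1| ≤ 2 * ‖w‖ * ‖u‖ := by
    rw [hQ1, abs_mul, abs_two, mul_assoc]
    exact mul_le_mul_of_nonneg_left (abs_real_inner_le_norm w u) zero_le_two
  have aP : |P| ≤ ‖w‖ * ‖d‖ := by rw [hP]; exact abs_real_inner_le_norm w d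
  have aP' : |⟪u, d⟫| ≤ ‖u‖ * ‖d‖ := abs_real_inner_le_norm u d
  have aH1 : |ljRadH1 S| ≤ 7 * S ^ 8 + 4 * S ^ 5 := by
    unfold ljRadH1; rw [abs_le]; constructor <;> linarith
  have aH2 : |ljRadH2 S| ≤ 56 * S ^ 9 + 20 * S ^ 6 := by
    unfold ljRadH2; rw [abs_le]; constructor <;> linarith
  have aH3 : |ljRadH3 S| ≤ 504 * S ^ 10 + 120 * S ^ 7 := by
    unfold ljRadH3; rw [abs_le]; constructor <;> linarith
  have aQ1sq : |Q1 ^ 2| ≤ 4 * Q * ‖u‖ ^ 2 := by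
    rw [abs_of_nonneg (sq_nonneg _), ← sq_abs, ← hwQ]
    have := pow_le_pow_left₀ (abs_nonneg _) aQ1 2
    nlinarith [this]
  have aPsq : |P ^ 2| ≤ Q * ‖d‖ ^ 2 := by
    rw [abs_of_nonneg (sq_nonneg _), ← sq_abs, ← hwQ]
    have := pow_le_pow_left₀ (abs_nonneg _) aP 2
    nlinarith [this]
  have aP'sq : |⟪u, d⟫ ^ 2| ≤ ‖u‖ ^ 2 * ‖d‖ ^ 2 := by
    rw [abs_of_nonneg (sq_nonneg _), ← sq_abs]
    have := pow_le_pow_left₀ (abs_nonneg _) aP' 2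
    nlinarith [this]
  have ad2 : |‖d‖ ^ 2| ≤ ‖d‖ ^ 2 := (abs_of_nonneg (sq_nonneg _)).le
  have au2 : |(2 : ℝ) * ‖u‖ ^ 2| ≤ 2 * ‖u‖ ^ 2 := (abs_of_nonneg (by positivity)).le
  have au4 : |(4 : ℝ) * ‖u‖ ^ 2| ≤ 4 * ‖u‖ ^ 2 := (abs_of_nonneg (by positivity)).le
  have a4 : |(4 : ℝ)| ≤ 4 := (abs_of_nonneg (by norm_num)).le
  have a2Q1sq : |2 * Q1 ^ 2| ≤ 8 * Q * ‖u‖ ^ 2 := by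
    rw [abs_mul, abs_two]; linarith
  have a8Q1P' : |8 * Q1 * ⟪u, d⟫| ≤ 16 * ‖w‖ * ‖u‖ ^ 2 * ‖d‖ := by
    rw [abs_mul, abs_mul, abs_of_nonneg (by norm_num : (0 : ℝ) ≤ 8)]
    have := mul_le_mul aQ1 aP' (abs_nonneg _) (by positivity)
    nlinarith [this]
  -- the six terms
  have hT1 := mul3_le_of_abs au2 aH1 ad2
  have hT2 := mul3_le_of_abs aQ1sq aH2 ad2
  have hT3 := mul3_le_of_abs au4 aH2 aPsq
  have hT4 := mul3_le_of_abs a2Q1sq aH3 aPsq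
  have hT5 := mul3_le_of_abs a8Q1P' aH2 aP
  have hT6 := mul3_le_of_abs a4 aH1 aP'sq
  have hexp : bondQF2 x u d t = 2 * ‖u‖ ^ 2 * ljRadH1 S * ‖d‖ ^ 2 + Q1 ^ 2 * ljRadH2 S * ‖d‖ ^ 2 +
      4 * ‖u‖ ^ 2 * ljRadH2 S * P ^ 2 + 2 * Q1 ^ 2 * ljRadH3 S * P ^ 2 + 8 * Q1 * ⟪u, d⟫ * ljRadH2 S * P +
      4 * ljRadH1 S * ⟪u, d⟫ ^ 2 := by
    unfold bondQF2; ring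
  have hsum : 2 * ‖u‖ ^ 2 * (7 * S ^ 8 + 4 * S ^ 5) * ‖d‖ ^ 2 + 4 * Q * ‖u‖ ^ 2 * (56 * S ^ 9 + 20 * S ^ 6) * ‖d‖ ^ 2 +
      4 * ‖u‖ ^ 2 * (56 * S ^ 9 + 20 * S ^ 6) * (Q * ‖d‖ ^ 2) + 8 * Q * ‖u‖ ^ 2 * (504 * S ^ 10 + 120 * S ^ 7) * (Q * ‖d‖ ^ 2) +
      16 * ‖w‖ * ‖u‖ ^ 2 * ‖d‖ * (56 * S ^ 9 + 20 * S ^ 6) * (‖w‖ * ‖d‖) + 4 * (7 * S ^ 8 + 4 * S ^ 5) * (‖u‖ ^ 2 * ‖d‖ ^ 2) =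
      ‖u‖ ^ 2 * ljPhiS S * ‖d‖ ^ 2 := by
    unfold ljPhiS
    linear_combination (‖u‖ ^ 2 * ‖d‖ ^ 2 * (24 * (56 * S ^ 8 + 20 * S ^ 5) + 8 * (504 * S ^ 8 + 120 * S ^ 7 * 0 + 120 * S ^ 5) * (Q * S + 1))) * hQS +
      (16 * ‖u‖ ^ 2 * ‖d‖ ^ 2 * (56 * S ^ 9 + 20 * S ^ 6)) * hwQ
  linarith [hT1, hT2, hT3, hT4, hT5, hT6, hexp, hsum]

/-! ### §5 The concavity package for the interpolation-vertex lemma -/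

/-- ★★ **CELLBOX-K ENTRY POINT DISCHARGED, PER BOND**: on a parameter interval where the bond stays at squared length `≥ q₀ > 0`,
`t ↦ ⟪d, K(x + t u) d⟫ − (‖u‖² Φ(q₀⁻¹) ‖d‖²)/2 · t²` is concave (ZZZYRCM `concaveOn_sub_sq_of_deriv2_le` with the closed-form derivatives). [g99] -/
theorem bondQF_concaveOn (x u d : E3) {l h q₀ : ℝ} (hq₀ : 0 < q₀) (hq : ∀ t ∈ Set.Icc l h, q₀ ≤ ‖x + t • u‖ ^ 2) :
    ConcaveOn ℝ (Set.Icc l h) (fun t => bondQF x u d t - ‖u‖ ^ 2 * ljPhiS q₀⁻¹ * ‖d‖ ^ 2 / 2 * t ^ 2) := by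
  have hpos : ∀ t ∈ Set.Icc l h, 0 < bondPathQ x u t := fun t ht => by
    rw [bondPathQ_eq_norm_sq]; exact hq₀.trans_le (hq t ht)
  refine concaveOn_sub_sq_of_deriv2_le (g' := bondQF1 x u d) (g'' := bondQF2 x u d)
    (fun t ht => hasDerivAt_bondQF x u d (hpos t ht).ne') (fun t ht => hasDerivAt_bondQF1 x u d (hpos t ht).ne') ?_
  intro t ht
  have hS0 : 0 ≤ bondS x u t := (inv_pos.mpr (hpos t ht)).le
  have hS : bondS x u t ≤ q₀⁻¹ := by
    unfold bondS; rw [bondPathQ_eq_norm_sq]; exact inv_anti₀ hq₀ (hq t ht)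
  have hΦ := ljPhiS_mono hS0 hS
  calc bondQF2 x u d t ≤ ‖u‖ ^ 2 * ljPhiS (bondS x u t) * ‖d‖ ^ 2 := bondQF2_le x u d (hpos t ht)
    _ ≤ ‖u‖ ^ 2 * ljPhiS q₀⁻¹ * ‖d‖ ^ 2 :=
        mul_le_mul_of_nonneg_right (mul_le_mul_of_nonneg_left hΦ (sq_nonneg _)) (sq_nonneg _)

/-- finite sums of bonds: the concavity constants add. [g99] -/
theorem concaveOn_sum_sub_sq {ι : Type*} (B : Finset ι) {s : Set ℝ} (hs : Convex ℝ s) {g : ι → ℝ → ℝ} {L : ι → ℝ}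
    (hg : ∀ b ∈ B, ConcaveOn ℝ s (fun t => g b t - L b / 2 * t ^ 2)) :
    ConcaveOn ℝ s (fun t => (∑ b ∈ B, g b t) - (∑ b ∈ B, L b) / 2 * t ^ 2) := by
  classical
  induction B using Finset.induction_on with
  | empty => simpa using concaveOn_const (0 : ℝ) hs
  | insert a B haB ih =>
    have h1 := hg a (Finset.mem_insert_self a B)
    have h2 := ih fun b hb => hg b (Finset.mem_insert_of_mem hb)
    have h := h1.add h2
    have e : (fun t => (∑ b ∈ insert a B, g b t) - (∑ b ∈ insert a B, L b) / 2 * t ^ 2) =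
        (fun t => g a t - L a / 2 * t ^ 2) + fun t => (∑ b ∈ B, g b t) - (∑ b ∈ B, L b) / 2 * t ^ 2 := by
      funext t
      simp only [Pi.add_apply, Finset.sum_insert haB]
      ring
    rw [e]; exact h

/-- a larger concavity constant is still a concavity constant. [g99] -/
theorem concaveOn_sub_sq_mono {s : Set ℝ} {g : ℝ → ℝ} {L₁ L₂ : ℝ} (hL : L₁ ≤ L₂)
    (h : ConcaveOn ℝ s (fun t => g t - L₁ / 2 * t ^ 2)) : ConcaveOn ℝ s (fun t => g t - L₂ / 2 * t ^ 2) := by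
  have hsq : ConvexOn ℝ s (fun t : ℝ => (L₂ - L₁) / 2 * t ^ 2) := by
    have h2 : ConvexOn ℝ s (fun t : ℝ => t ^ 2) := (Even.convexOn_pow (by decide : Even 2)).subset (Set.subset_univ _) h.1
    simpa [smul_eq_mul] using h2.smul (by linarith : (0 : ℝ) ≤ (L₂ - L₁) / 2)
  have hadd := h.add hsq.neg
  have e : (fun t => g t - L₂ / 2 * t ^ 2) = (fun t => g t - L₁ / 2 * t ^ 2) + -(fun t : ℝ => (L₂ - L₁) / 2 * t ^ 2) := by
    funext t; simp only [Pi.add_apply, Pi.neg_apply]; ring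
  rw [e]; exact hadd

end Summit.AtomisticToContinuum.Crystallization.Theorems.ChartedZeroExcessLayeredLatticeLiouville
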